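import Summits.QuantumFields.BalabanUV.Beta.FP.PerfectColumnKronecker
import Summits.QuantumFields.BalabanUV.Beta.D1BFx.MomentTransferKroneckerWard

/-!
# `BalabanUV.Beta.D1BFx.FineHessianWardKronecker` — road «BF-x» for binder row D1, sub-leaf A4-leg ∕ K-R5 (Ward socket): THE A4 ∕ K-R5 ENDs OVER
# ANY LEG AT THE ROAD'S ENTRY `κ, λ ∈ {μ, ν}` FROM THE WARD LAWS (W1)∕(W2) ALONE — the relabelling ∕ reflection socket `Φ, hAr, a, σ, hSr, hWr` of
# leaf-01's `FineHessianWard.bondSecondMoment_TOfLeg_eq_avgM2_of_laws` DROPPED (the typed solution operator's kernel `wK` has the Kronecker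
# first-moment row: `FP/PerfectColumnKronecker.linReproSum_wH_offDiag`)

HONEST DEPENDENCY (page 1, mandatory): continuum YM on T⁴ ⇐ BetaPertH ∧ nine spine estimates (0/9 proved); BetaPertH ⇐ (D1) ∧ (D4) ∧
CAP+tail; G-an2-4 gates asym, D1 and NE2/3/4.  HONEST FRAMING (cell contract, verbatim): «discharging `BetaPertH` makes Bałaban's UV
stability UNCONDITIONAL — a real constructive-QFT result; it is NOT the continuum limit and NOT the Clay problem.»  THIS MODULE DISCHARGES
NOTHING of D1 / BetaPertH: [folklore] bookkeeping BY NAME over leaf-01's `ReducedKernelSandwichLeg` ∕ `FineHessianWard`, an2's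
`MinimiserIdentityForm.lowMoments_wK`, and this lineage's `MomentTransferKroneckerWard` ∕ `FP/PerfectColumnKronecker` (gen 4).  The laws (W1)∕(W2) are
HYPOTHESES on the road's objects (whether Bałaban's jets satisfy them is nodes J ∕ K-R2 ∕ CHECK-N0, NOT asserted).  No `def`, no `Prop` mirror, no
cited fact, 0 sorry; 0 wall binders; NOT D1, NOT BetaPertH, NOT continuum, NOT Clay.

ABSOLUTE RULE (cell charter, verbatim): «No internally-minted statement may enter as a cited fact. Every hypothesis is either
kernel-proved in this package or a verbatim quotation of a PUBLISHED theorem with page reference. The manuscript(s) under audit are NOT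
citable for their own disputed steps — they are the thing under adjudication; programme-internal (2001/route/tribunal) claims are never
citable.»

WHY (skeleton v1.4 node R5: «the MAIN TERM needs (T0) … NOT diagram by diagram»; sub-leaf A4-leg-PARITY).  leaf-01's END from sockets
`bondSecondMoment_TOfLeg_eq_avgM2_of_laws` feeds K-R5's `hrow` from (W1)∕(W2) (`divFree_fineHessA_of_wardLaws` + `hasSum_col_of_divFree`) but
still carries an inversion-type RELABELLING socket (`Φ`, `hAr : refK Φ A = A`, centres `a`, bond signs `σ`, laws `hSr`∕`hWr`) for K-R5's `hT1`.
For the entries `κ, λ ∈ {μ, ν}` — in particular `(κ, λ) = (μ, ν)`, `B12Beta.secondMoment`'s shape — that socket is NOT NEEDED: the SAME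
first-bond divergence-freeness gives the diagonal first moments (`MomentTransferKroneckerWard.hasSum_diagFirstMoment_of_divFree`, the quadratic-gauge
Ward identity), `wK`'s Kronecker first-moment row (`linReproSum_wH_offDiag`) confines the cross terms to the `(μ, ν)` entry, and the Hessian
symmetry `fineHessA_transpose` kills them.  So for the corner-rooted objects of record — which have NO reflection relabelling (an5
`CornerRootInstance.axProj_not_reflectionCovariant`) — the A4 ∕ K-R5 END at the road's entry is available from the Ward laws alone.

CONTENT (all [folklore] / [our object]): **`bondSecondMomentP_solutionOp_four_of_divFree`** (`wK`-dressed sandwich, any first-bond divergence-free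
transposition-symmetric block-periodic `P`; `κ, λ ∈ {a, b}`), **`bondSecondMoment_TOfLeg_eq_avgM2_of_divFree`** (any leg; `hrow` + `hT1` ↦ `hdiv`),
**`bondSecondMoment_TOfLeg_eq_avgM2_of_wardLaws'`** ((W1)∕(W2) + block covariance ONLY; `κ, λ ∈ {μ, ν}`).
Unit `b2b-balaban-beta-d1-formalise-leaf-02` (gen 4).
-/

noncomputable section

namespace Summit.QuantumFields.BalabanUV.Beta.D1BFx.FineHessianWardKronecker

open Finset
open scoped BigOperators
open Literature.MathematicalPhysics.QuantumFieldTheory.Balaban1983to89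
open Literature.MathematicalPhysics.QuantumFieldTheory.Balaban1983to89.Beta
open B6BondElimination (unitVec)
open ExpKernelCalculus (Site MKer Decays BiLoc comp shiftK)
open DecimatedMomentSummable (AbsMoment₂)
open DressedMomentNormalisation (EKer resSite)
open MinimiserIdentityForm (wK lowMoments_wK absMoment₂_wK)
open KernelWard (divV divW)
open Summit.QuantumFields.BalabanUV.Beta.TameKernelCalculus
open Summit.QuantumFields.BalabanUV.Beta.D1BFx.ReducedKernelF (TOfLeg)
open Summit.QuantumFields.BalabanUV.Beta.D1BFx.ReducedTableF (tableRedF)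
open Summit.QuantumFields.BalabanUV.Beta.D1BFx.MomentTransferPeriodic (Ker₂ IsBlockPeriodic baseKer)
open Summit.QuantumFields.BalabanUV.Beta.D1BFx.MomentTransferPeriodicEntry (EKer₂ dressedEntryP avgM2)
open Summit.QuantumFields.BalabanUV.Beta.D1BFx.MomentTransferKroneckerWard (bondSecondMomentP_tsum_four_of_divFree)
open Summit.QuantumFields.BalabanUV.Beta.D1BFx.ReducedKernelSandwichLeg (fineHessA isBlockPeriodic_fineHessA absMoment₂_baseKer_fineHessA
  fineHessA_transpose TOfLeg_tableRedF_eq_dressedEntryP)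
open Summit.QuantumFields.BalabanUV.Beta.D1BFx.FineHessianWard (divFree_fineHessA_of_wardLaws)
open Summit.QuantumFields.BalabanUV.Beta.FP.PerfectColumnKronecker (linReproSum_wH_offDiag linReproSum_kronecker_of_offDiag
  divFree_single_of_unitVec)

/-! ## §1 The `wK`-dressed sandwich: Ward data only -/

/-- [folklore] **THE SANDWICH DRESSED BY THE TYPED SOLUTION OPERATOR, AT THE ENTRIES `κ, λ ∈ {a, b}`, FROM WARD DATA ONLY** (`d + 1 = 4`, block
size `N ≠ 0`): for the response kernel `wK N` (its (L0∞)∕(L1∞)∕`AbsMoment₂` = `lowMoments_wK`∕`absMoment₂_wK`; its KRONECKER first-moment row =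
`PerfectColumnKronecker.linReproSum_wH_offDiag`) and ANY block-periodic transposition-symmetric matrix two-point kernel `P` with absolutely summable
base-point kernels which is DIVERGENCE-FREE IN THE FIRST BOND: `Σ'_z z_κ z_λ · N⁸ · dressedEntryP (wK N) P (N•z) a b = avgM2 N (P a b) κ λ` —
`MomentTransferPeriodicEntry.bondSecondMomentP_solutionOp_four` with `hcol` + `hrow` + `hT1` REPLACED by `hsymm` + `hdiv`. -/
theorem bondSecondMomentP_solutionOp_four_of_divFree {N : ℕ} [NeZero N] (P : EKer₂ 4) (hP : ∀ c e, IsBlockPeriodic N (P c e))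
    (hsymm : ∀ c e s s', P c e s s' = P e c s' s)
    (hdiv : ∀ (e : Fin 4) (u' u : Site 4), ∑ c : Fin 4, (P c e (u - Pi.single c 1) u' - P c e u u') = 0)
    (hPA : ∀ c e b, AbsMoment₂ (baseKer (P c e) b)) {κ lam a b : Fin 4} (hκ : κ = a ∨ κ = b) (hlam : lam = a ∨ lam = b) :
    ∑' z : Fin 4 → ℤ, ((z κ * z lam : ℤ) : ℝ) * ((N : ℝ) ^ 8 * dressedEntryP (wK N) P ((N : ℤ) • z) a b)
      = avgM2 N (P a b) κ lam := by
  obtain ⟨C1, hC1⟩ := linReproSum_kronecker_of_offDiag (w := wK N) lowMoments_wK.2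
    (fun κ' l h => linReproSum_wH_offDiag (d := 3) (N := N) h)
  exact bondSecondMomentP_tsum_four_of_divFree (Nat.pos_of_ne_zero (NeZero.ne N)) (wK N) P hP hsymm hdiv lowMoments_wK.1 hC1
    absMoment₂_wK hPA hκ hlam

/-! ## §2 The reduced kernel over any leg: A4 ∕ K-R5 at the road's entry from first-bond divergence-freeness -/

variable {F : Type*} [Fintype F] [Nonempty F] (n : ℕ) [NeZero n]
variable (A : MKer 4 F) {S : Fin 4 → Site 4 → MKer 4 F} {Wf : Fin 4 → Site 4 → Fin 4 → Site 4 → MKer 4 F} {Cs C2 Cx δ : ℝ}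

/-- [folklore] **A4 OVER ANY LEG AT THE ENTRIES `κ, λ ∈ {μ, ν}` — FIRST-BOND DIVERGENCE-FREENESS IN, RELABELLING OUT.**  Leg `A` spread and block
covariant; `S` self-localised and fine-translation covariant; `Wf` bi-localised, jointly covariant and SYMMETRIC; GIVEN that the fine Hessian kernel
`fineHessA A S Wf` is divergence-free in the first bond: `Σ'_z z_κ z_λ · n⁸ · TOfLeg n A S (tableRedF n Wf) μ ν z = avgM2 n (fineHessA A S Wf μ ν) κ λ`
for `κ, λ ∈ {μ, ν}` (leaf-01's `ReducedKernelSandwichLeg.bondSecondMoment_TOfLeg_eq_avgM2` with `hrow` + `hT1` ↦ `hdiv`). -/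
theorem bondSecondMoment_TOfLeg_eq_avgM2_of_divFree (hA : Spr A) (hAcov : ∀ t : Site 4, shiftK (-((n : ℤ) • t)) A = A)
    (hS : ∀ κ' u, BiLoc (S κ' u) u u Cs δ) (hW : ∀ κ' u l' u', BiLoc (Wf κ' u l' u') u u' C2 δ) (hδ : 0 < δ)
    (hScov : ∀ (κ' : Fin 4) (u v : Site 4), S κ' (u + v) = shiftK (-v) (S κ' u))
    (hWcov : ∀ (κ' : Fin 4) (u : Site 4) (l' : Fin 4) (u' v : Site 4), Wf κ' (u + v) l' (u' + v) = shiftK (-v) (Wf κ' u l' u'))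
    (hWsymm : ∀ (κ' : Fin 4) (u : Site 4) (l' : Fin 4) (u' : Site 4), Wf κ' u l' u' = Wf l' u' κ' u)
    (hdiv : ∀ (l' : Fin 4) (u' u : Site 4), ∑ κ' : Fin 4, (fineHessA A S Wf κ' l' (u - Pi.single κ' 1) u' - fineHessA A S Wf κ' l' u u') = 0)
    {κ lam μ ν : Fin 4} (hκ : κ = μ ∨ κ = ν) (hlam : lam = μ ∨ lam = ν) :
    ∑' z : Site 4, ((z κ * z lam : ℤ) : ℝ) * ((n : ℝ) ^ 8 * TOfLeg n A S (tableRedF n Wf) μ ν z)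
      = avgM2 n (fineHessA A S Wf μ ν) κ lam := by
  have h := bondSecondMomentP_solutionOp_four_of_divFree (N := n) (fineHessA A S Wf) (isBlockPeriodic_fineHessA n A hAcov hScov hWcov)
    (fun c e s s' => fineHessA_transpose A hA hS hδ hWsymm c e s s') hdiv (absMoment₂_baseKer_fineHessA A hA hS hW hδ) hκ hlam
  rw [← h, ← (Equiv.neg (Site 4)).tsum_eq]
  refine tsum_congr fun z => ?_
  rw [TOfLeg_tableRedF_eq_dressedEntryP n A hA hAcov hS hW hδ hScov hWcov μ ν]
  simp only [Equiv.neg_apply, Pi.neg_apply, neg_mul_neg, neg_neg]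

/-- [folklore] **A4 ∕ K-R5 OVER ANY LEG FROM THE WARD LAWS ONLY, AT THE ENTRIES `κ, λ ∈ {μ, ν}`** (block-covariant data): leg spread and block
covariant; stencils∕tables bi-localised, translation covariant, table symmetric; gauge generator `X` with (W1) `(A ∘ divV S u) ∘ A = A ∘ X u − X u ∘ A`
and (W2) `divW Wf u λ′ u′ = X u ∘ S λ′ u′ − S λ′ u′ ∘ X u` ⟹ `Σ′_z z_κ z_λ · n⁸ · TOfLeg n A S (tableRedF n Wf) μ ν z = avgM2 n (fineHessA A S Wf μ ν) κ λ` —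
leaf-01's `FineHessianWard.bondSecondMoment_TOfLeg_eq_avgM2_of_laws` WITHOUT its relabelling socket `Φ ∕ hAr ∕ a ∕ σ ∕ hSr ∕ hWr`; NO hypothesis on
the composite kernel and NO reflection law remains. -/
theorem bondSecondMoment_TOfLeg_eq_avgM2_of_wardLaws' (hA : Spr A) (hAcov : ∀ t : Site 4, shiftK (-((n : ℤ) • t)) A = A)
    (hS : ∀ κ' u, BiLoc (S κ' u) u u Cs δ) (hW : ∀ κ' u l' u', BiLoc (Wf κ' u l' u') u u' C2 δ) (hδ : 0 < δ)
    (hScov : ∀ (κ' : Fin 4) (u v : Site 4), S κ' (u + v) = shiftK (-v) (S κ' u))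
    (hWcov : ∀ (κ' : Fin 4) (u : Site 4) (l' : Fin 4) (u' v : Site 4), Wf κ' (u + v) l' (u' + v) = shiftK (-v) (Wf κ' u l' u'))
    (hWsymm : ∀ (κ' : Fin 4) (u : Site 4) (l' : Fin 4) (u' : Site 4), Wf κ' u l' u' = Wf l' u' κ' u)
    (X : Site 4 → MKer 4 F) (hX : ∀ u, BiLoc (X u) u u Cx δ)
    (hW1 : ∀ u, comp (comp A (divV S u)) A = comp A (X u) - comp (X u) A)
    (hW2 : ∀ (u : Site 4) (l' : Fin 4) (u' : Site 4), divW Wf u l' u' = comp (X u) (S l' u') - comp (S l' u') (X u))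
    {κ lam μ ν : Fin 4} (hκ : κ = μ ∨ κ = ν) (hlam : lam = μ ∨ lam = ν) :
    ∑' z : Site 4, ((z κ * z lam : ℤ) : ℝ) * ((n : ℝ) ^ 8 * TOfLeg n A S (tableRedF n Wf) μ ν z)
      = avgM2 n (fineHessA A S Wf μ ν) κ lam :=
  bondSecondMoment_TOfLeg_eq_avgM2_of_divFree n A hA hAcov hS hW hδ hScov hWcov hWsymm
    (divFree_single_of_unitVec (divFree_fineHessA_of_wardLaws A X hA hS hW hX hδ hW1 hW2)) hκ hlam

end Summit.QuantumFields.BalabanUV.Beta.D1BFx.FineHessianWardKronecker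

end
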